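import Mathlib
import Summits.CriticalPhenomena.Ising3DConformalLimit.Theorems.MarkovRigidityFieldRealisationMomentLimit
import Summits.CriticalPhenomena.Ising3DConformalLimit.Theorems.MoebiusLimitExists.Negative.TwoPointPositivity
import Literature.Analysis.FunctionSpaces.MinlosSchwartzProofs
import Literature.MathematicalPhysics.QuantumLattice.RandomFieldProofs
import Literature.Probability.LatticeModels.AizenmanWickBound
import Literature.Probability.LatticeModels.FieldScalingLimitTrivialityProofs
import HarnessLib

/-!
# Route MarkovRigidity, support item `FieldRealisation` (stmt-CriticalPhenomena-11245):
# the limit characteristic functional and the continuum law (Minlos)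

Helper towards clause (b) of `FieldRealisation`.  The limit `C(f) = Σₙ iⁿ mₙ(f,…,f)/n!` of the
generating functionals of the smeared critical field (`tendsto_genFunctional_spinFieldLaw`) is a
CHARACTERISTIC FUNCTIONAL on `𝒮(ℝ³)`: normalised (`C(0) = 1`), positive definite (a pointwise limit
of positive definite functionals) and continuous — the continuity estimate is
`|C(f) − C(g)| ≤ η/2 + Q(f−g)/(2η)` for every `η > 0`, where the limit variance
`Q(h) = ∫ h(x₀)h(x₁) S₂(x) dx` is bounded by a continuous Schwartz seminorm through the kernel bound
`S₂ ≤ C·max(1,‖x₀−x₁‖^{-a})`.  By MINLOS' THEOREM for Schwartz space (tree: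
`schwartz_minlos_holds`) there is a probability law `μ` on `FieldConfig ℝ³` with `S_μ = C`, and the
smeared laws converge to it in law (`exists_limitLaw`).

References: Gel'fand–Vilenkin IV §4; Glimm–Jaffe 1987 §6.1, Thm A.6.1; Fernique 1967.
No definitions are introduced.
-/

noncomputable section

namespace Summit.CriticalPhenomena.Ising3DConformalLimit.MarkovRigidityFieldRealisation

open MeasureTheory Filter Complex Literature.Probability.LatticeModels
  Literature.MathematicalPhysics.QuantumLattice
open Summit.CriticalPhenomena.Ising3DConformalLimit
open scoped Topology Nat ENNReal

variable {ρ : ℝ → ℝ} {Δ : ℝ} {S : CorrFamily 3}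
variable {ν : Measure (SpinConfig (Site 3))} [IsProbabilityMeasure ν]
variable {L : ℝ → ℕ}

/-! ### The limit functional is normalised and positive definite -/

/-- **`C(0) = 1`.** [cite: GelfandVilenkinIV1964, Ch. IV §4.2 Thm. 1 (p. 348)] -/
theorem limitFunctional_zero (hlim : HasPointwiseScalingLimit (criticalCorr 3) ρ S)
    (hnd : IsNondegenerateTwoPoint S) (hsc : IsScaleCovariant Δ S) (hΔ0 : 0 < Δ) (hΔ : Δ < 3 / 2)
    (hν : ∀ A : Finset (Site 3), spinCorr ν A = plusCorr 3 (criticalBeta 3) 0 A)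
    (hL : Tendsto (fun δ => δ * L δ) (𝓝[>] 0) atTop) :
    (∑' n : ℕ, I ^ n * ((∫ x : Fin n → EuclideanSpace ℝ (Fin 3),
      (∏ i, (0 : SchwartzMap (EuclideanSpace ℝ (Fin 3)) ℝ) (x i)) * S n x : ℝ) : ℂ) / n !) = 1 := by
  have h := tendsto_genFunctional_spinFieldLaw hlim hnd hsc hΔ0 hΔ hν hL 0
  have h1 : ∀ δ, genFunctional (spinFieldLaw ν (box 3 (L δ)) δ (ρ δ)) 0 = 1 := fun δ =>
    (isCharacteristicFunctional_genFunctional_holds (spinFieldLaw ν (box 3 (L δ)) δ (ρ δ))).1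
  simp_rw [h1] at h
  exact tendsto_nhds_unique h tendsto_const_nhds

/-- **The limit functional is positive definite**: a pointwise limit of the positive definite
generating functionals `S_{P_δ}`. [cite: GelfandVilenkinIV1964, Ch. IV §4.2 Thm. 1 (p. 348)] -/
theorem limitFunctional_posDef (hlim : HasPointwiseScalingLimit (criticalCorr 3) ρ S)
    (hnd : IsNondegenerateTwoPoint S) (hsc : IsScaleCovariant Δ S) (hΔ0 : 0 < Δ) (hΔ : Δ < 3 / 2)
    (hν : ∀ A : Finset (Site 3), spinCorr ν A = plusCorr 3 (criticalBeta 3) 0 A)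
    (hL : Tendsto (fun δ => δ * L δ) (𝓝[>] 0) atTop) :
    IsPositiveDefiniteFunctional (fun f : SchwartzMap (EuclideanSpace ℝ (Fin 3)) ℝ =>
      ∑' n : ℕ, I ^ n * ((∫ x : Fin n → EuclideanSpace ℝ (Fin 3),
        (∏ i, f (x i)) * S n x : ℝ) : ℂ) / n !) := by
  intro k f c
  set P : ℝ → Measure (FieldConfig (EuclideanSpace ℝ (Fin 3))) :=
    fun δ => spinFieldLaw ν (box 3 (L δ)) δ (ρ δ) with hP
  -- the finite sums converge
  have hT : Tendsto (fun δ => ∑ i, ∑ j, (starRingEnd ℂ) (c i) * c j *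
      genFunctional (P δ) (f j - f i)) (𝓝[>] 0)
      (𝓝 (∑ i, ∑ j, (starRingEnd ℂ) (c i) * c j * ∑' n : ℕ, I ^ n *
        ((∫ x : Fin n → EuclideanSpace ℝ (Fin 3), (∏ l, (f j - f i) (x l)) * S n x : ℝ) : ℂ) / n !)) :=
    tendsto_finsetSum _ fun i _ => tendsto_finsetSum _ fun j _ =>
      (tendsto_genFunctional_spinFieldLaw hlim hnd hsc hΔ0 hΔ hν hL (f j - f i)).const_mul _
  have hPD : ∀ δ, 0 ≤ (∑ i, ∑ j, (starRingEnd ℂ) (c i) * c j * genFunctional (P δ) (f j - f i)).re ∧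
      (∑ i, ∑ j, (starRingEnd ℂ) (c i) * c j * genFunctional (P δ) (f j - f i)).im = 0 := fun δ =>
    (isCharacteristicFunctional_genFunctional_holds (P δ)).2.2 k f c
  constructor
  · exact ge_of_tendsto' ((continuous_re.tendsto _).comp hT) fun δ => (hPD δ).1
  · have h2 : Tendsto (fun δ => (∑ i, ∑ j, (starRingEnd ℂ) (c i) * c j *
        genFunctional (P δ) (f j - f i)).im) (𝓝[>] 0) (𝓝 0) :=
      tendsto_const_nhds.congr' (Eventually.of_forall fun δ => ((hPD δ).2).symm)
    exact tendsto_nhds_unique ((continuous_im.tendsto _).comp hT) h2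

/-! ### Continuity of the limit functional -/

/-- `|x| ≤ η/2 + x²/(2η)` for `η > 0`. [folklore] -/
theorem abs_le_half_add_sq_div {η : ℝ} (hη : 0 < η) (x : ℝ) : |x| ≤ η / 2 + x ^ 2 / (2 * η) := by
  have h : 0 ≤ (|x| - η) ^ 2 := sq_nonneg _
  rw [sub_sq, sq_abs] at h
  rw [div_add_div _ _ (two_ne_zero) (by positivity), le_div_iff₀ (by positivity)]
  nlinarith

/-- **Increment bound for generating functionals**: for a probability law `P` on field
configurations with `ω(f − g)` square integrable and every `η > 0`,
`‖S_P(f) − S_P(g)‖ ≤ η/2 + E_P[ω(f−g)²]/(2η)` (`|e^{ia} − 1| ≤ |a|` and `|a| ≤ η/2 + a²/(2η)`).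
[cite: GelfandVilenkinIV1964, Ch. IV §4.2 Thm. 1 (p. 348)] -/
theorem norm_genFunctional_sub_le (P : Measure (FieldConfig (EuclideanSpace ℝ (Fin 3))))
    [IsProbabilityMeasure P] (f g : SchwartzMap (EuclideanSpace ℝ (Fin 3)) ℝ)
    (hint : Integrable (fun ω : FieldConfig (EuclideanSpace ℝ (Fin 3)) => (ω (f - g)) ^ 2) P)
    {η : ℝ} (hη : 0 < η) :
    ‖genFunctional P f - genFunctional P g‖ ≤ η / 2 + (∫ ω, (ω (f - g)) ^ 2 ∂P) / (2 * η) := by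
  have hmeas : ∀ h : SchwartzMap (EuclideanSpace ℝ (Fin 3)) ℝ, Integrable
      (fun ω : FieldConfig (EuclideanSpace ℝ (Fin 3)) => cexp (I * ((ω h : ℝ) : ℂ))) P := fun h =>
    Integrable.of_bound ((Complex.continuous_exp.comp (continuous_const.mul
      (Complex.continuous_ofReal.comp (continuous_eval_const h)))).aestronglyMeasurable) 1
      (Eventually.of_forall fun ω => by rw [Complex.norm_exp_I_mul_ofReal])
  unfold genFunctional
  rw [← integral_sub (hmeas f) (hmeas g)]
  calc ‖∫ ω, (cexp (I * ((ω f : ℝ) : ℂ)) - cexp (I * ((ω g : ℝ) : ℂ))) ∂P‖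
      ≤ ∫ ω, ‖cexp (I * ((ω f : ℝ) : ℂ)) - cexp (I * ((ω g : ℝ) : ℂ))‖ ∂P :=
        norm_integral_le_integral_norm _
    _ ≤ ∫ ω, (η / 2 + (ω (f - g)) ^ 2 / (2 * η)) ∂P := by
        refine integral_mono_of_nonneg (Eventually.of_forall fun ω => norm_nonneg _)
          ((integrable_const _).add (hint.div_const _)) (Eventually.of_forall fun ω => ?_)
        have hsub : (ω f : ℝ) = ω (f - g) + ω g := by rw [map_sub]; ring
        calc ‖cexp (I * ((ω f : ℝ) : ℂ)) - cexp (I * ((ω g : ℝ) : ℂ))‖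
            = ‖cexp (I * ((ω g : ℝ) : ℂ)) * (cexp (I * ((ω (f - g) : ℝ) : ℂ)) - 1)‖ := by
              rw [hsub]; push_cast; rw [mul_add, Complex.exp_add]; ring_nf
          _ = ‖cexp (I * ((ω (f - g) : ℝ) : ℂ)) - 1‖ := by
              rw [norm_mul, Complex.norm_exp_I_mul_ofReal, one_mul]
          _ ≤ ‖(ω (f - g) : ℝ)‖ := Real.norm_exp_I_mul_ofReal_sub_one_le
          _ ≤ η / 2 + (ω (f - g)) ^ 2 / (2 * η) := by
              rw [Real.norm_eq_abs]; exact abs_le_half_add_sq_div hη _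
    _ = η / 2 + (∫ ω, (ω (f - g)) ^ 2 ∂P) / (2 * η) := by
        rw [integral_add (integrable_const _) (hint.div_const _), integral_const, probReal_univ,
          one_smul, integral_div]

/-- **Increment bound for the limit functional**: for every `η > 0`,
`‖C(f) − C(g)‖ ≤ η/2 + Q(f−g)/(2η)` with the limit variance `Q(h) = ∫ h(x₀)h(x₁) S₂(x) dx`.
[cite: GlimmJaffe1987, §6.1] -/
theorem norm_limitFunctional_sub_le (hlim : HasPointwiseScalingLimit (criticalCorr 3) ρ S)
    (hnd : IsNondegenerateTwoPoint S) (hsc : IsScaleCovariant Δ S) (hΔ0 : 0 < Δ) (hΔ : Δ < 3 / 2)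
    (hν : ∀ A : Finset (Site 3), spinCorr ν A = plusCorr 3 (criticalBeta 3) 0 A)
    (hL : Tendsto (fun δ => δ * L δ) (𝓝[>] 0) atTop)
    (f g : SchwartzMap (EuclideanSpace ℝ (Fin 3)) ℝ) {η : ℝ} (hη : 0 < η) :
    ‖(∑' n : ℕ, I ^ n * ((∫ x : Fin n → EuclideanSpace ℝ (Fin 3),
        (∏ i, f (x i)) * S n x : ℝ) : ℂ) / n !) -
      (∑' n : ℕ, I ^ n * ((∫ x : Fin n → EuclideanSpace ℝ (Fin 3),
        (∏ i, g (x i)) * S n x : ℝ) : ℂ) / n !)‖ ≤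
      η / 2 + (∫ x : Fin 2 → EuclideanSpace ℝ (Fin 3), (∏ i, (f - g) (x i)) * S 2 x) / (2 * η) := by
  set P : ℝ → Measure (FieldConfig (EuclideanSpace ℝ (Fin 3))) :=
    fun δ => spinFieldLaw ν (box 3 (L δ)) δ (ρ δ) with hP
  have hf := tendsto_genFunctional_spinFieldLaw hlim hnd hsc hΔ0 hΔ hν hL f
  have hg := tendsto_genFunctional_spinFieldLaw hlim hnd hsc hΔ0 hΔ hν hL g
  have hQ := tendsto_moment_spinFieldLaw hlim hnd hsc hΔ0 hΔ hν hL (fun _ : Fin 2 => f - g)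
  simp_rw [moment_const_eq_integral_pow] at hQ
  refine le_of_tendsto_of_tendsto' ((continuous_norm.tendsto _).comp (hf.sub hg))
    (tendsto_const_nhds.add (hQ.div_const _)) fun δ => ?_
  haveI : IsProbabilityMeasure (P δ) := by rw [hP]; infer_instance
  refine norm_genFunctional_sub_le (P δ) f g ?_ hη
  rw [hP]
  exact (integrable_spinFieldLaw_eval_iff ν (box 3 (L δ)) δ (ρ δ) (f - g) (continuous_pow 2)).2
    (Integrable.of_bound (((measurable_eval (f - g)).comp (measurable_spinField _ δ (ρ δ))).pow_const
      2).aestronglyMeasurable ((∑ x ∈ box 3 (L δ), |ρ δ * δ ^ 3 * (f - g) (δ • siteToE x)|) ^ 2)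
      (Eventually.of_forall fun σ => by
        rw [Real.norm_eq_abs, abs_pow]
        exact pow_le_pow_left₀ (abs_nonneg _) (abs_spinField_apply_le _ δ (ρ δ) σ (f - g)) 2))

/-- **The limit variance is dominated by a Schwartz seminorm**: there is `A ≥ 0` with
`|∫ h(x₀)h(x₁) S₂(x) dx| ≤ A · (2⁴ Σ_{m ≤ (4,0)} ‖h‖_m)²` for every test function `h`
(kernel bound `S₂ ≤ C 4^a max(1,‖x₀−x₁‖^{-a})` from `rescaledCorrelator_le_pairingSum_kernel`, and
integrability of the weighted kernel). [cite: GlimmJaffe1987, §6.1] -/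
theorem exists_limitVariance_le (hlim : HasPointwiseScalingLimit (criticalCorr 3) ρ S)
    (hnd : IsNondegenerateTwoPoint S) (hsc : IsScaleCovariant Δ S) (hΔ0 : 0 < Δ) (hΔ : Δ < 3 / 2) :
    ∃ A : ℝ, 0 ≤ A ∧ ∀ h : SchwartzMap (EuclideanSpace ℝ (Fin 3)) ℝ,
      |∫ x : Fin 2 → EuclideanSpace ℝ (Fin 3), (∏ i, h (x i)) * S 2 x| ≤
        A * (2 ^ 4 * ((Finset.Iic ((4, 0) : ℕ × ℕ)).sup (schwartzSeminormFamily ℝ (EuclideanSpace ℝ (Fin 3)) ℝ)) h) ^ 2 := by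
  obtain ⟨a, C, δ₀, ha2, ha3, hC, hδ₀, hK⟩ := rho_sq_mul_criticalTwoPoint_le hlim hnd hsc hΔ0 hΔ
  have ha0 : 0 ≤ a := by linarith
  set Kc : EuclideanSpace ℝ (Fin 3) → EuclideanSpace ℝ (Fin 3) → ℝ :=
    fun p q => max 1 (‖p - q‖ ^ (-a)) with hKc
  set D : (Fin (2 * 1) → EuclideanSpace ℝ (Fin 3)) → ℝ := fun x =>
    (∏ i, (1 + ‖x i‖) ^ (-(4 : ℝ))) * pairingSum Kc 1 x with hD
  have hDint : Integrable D := by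
    have h := integrable_weight_mul_pairingSum (N := 4) ha0 ha3 (by norm_num) 1
    rw [← volume_pi] at h
    exact h
  have hD0 : ∀ x, 0 ≤ D x := fun x => mul_nonneg (Finset.prod_nonneg fun i _ => weight_nonneg 4 _)
    (pairingSum_nonneg (fun p q => le_trans zero_le_one (le_max_left _ _)) 1 x)
  -- the kernel bound passes to the limit two-point function
  have hS2 : ∀ x : Fin (2 * 1) → EuclideanSpace ℝ (Fin 3), x ∈ NonCoincident 3 (2 * 1) →
      0 ≤ S 2 x ∧ S 2 x ≤ (C * (4 : ℝ) ^ a) * pairingSum Kc 1 x := by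
    intro x hx
    refine ⟨MoebiusLimitExistsNegative.limit_two_nonneg hlim hx, ?_⟩
    have ht := (hlim (2 * 1)).tendsto_at hx
    refine le_of_tendsto ht ?_
    filter_upwards [Ioo_mem_nhdsGT hδ₀] with δ hδ
    have h := (rescaledCorrelator_le_pairingSum_kernel ha0 hK hδ.1 hδ.2 hx).2
    rwa [pow_one] at h
  refine ⟨C * (4 : ℝ) ^ a * ∫ x, D x, mul_nonneg (by positivity) (integral_nonneg (μ := volume) (f := D) hD0), fun h => ?_⟩
  set s : ℝ := 2 ^ 4 * ((Finset.Iic ((4, 0) : ℕ × ℕ)).sup (schwartzSeminormFamily ℝ (EuclideanSpace ℝ (Fin 3)) ℝ)) h with hs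
  have hs0 : 0 ≤ s := by positivity
  have hhs : ∀ p, |h p| ≤ s * (1 + ‖p‖) ^ (-(4 : ℝ)) := fun p => abs_le_seminorm_mul_weight h p
  -- pointwise domination almost everywhere
  have hdom : ∀ᵐ x : Fin (2 * 1) → EuclideanSpace ℝ (Fin 3),
      ‖(∏ i, h (x i)) * S 2 x‖ ≤ s ^ 2 * (C * (4 : ℝ) ^ a) * D x := by
    filter_upwards [ae_mem_nonCoincident (2 * 1)] with x hx
    obtain ⟨h0, hle⟩ := hS2 x hx
    rw [Real.norm_eq_abs, abs_mul, abs_of_nonneg h0, Finset.abs_prod]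
    have hprod : ∏ i, |h (x i)| ≤ ∏ i, (s * (1 + ‖x i‖) ^ (-(4 : ℝ))) :=
      Finset.prod_le_prod (fun i _ => abs_nonneg _) fun i _ => hhs _
    rw [Finset.prod_mul_distrib, Finset.prod_const, Finset.card_univ, Fintype.card_fin] at hprod
    calc (∏ i, |h (x i)|) * S 2 x ≤ (s ^ (2 * 1) * ∏ i, (1 + ‖x i‖) ^ (-(4 : ℝ))) *
          ((C * (4 : ℝ) ^ a) * pairingSum Kc 1 x) :=
          mul_le_mul hprod hle h0 (by positivity)
      _ = s ^ 2 * (C * (4 : ℝ) ^ a) * D x := by rw [hD]; ring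
  calc |∫ x : Fin 2 → EuclideanSpace ℝ (Fin 3), (∏ i, h (x i)) * S 2 x|
      = ‖∫ x : Fin (2 * 1) → EuclideanSpace ℝ (Fin 3), (∏ i, h (x i)) * S 2 x‖ := rfl
    _ ≤ ∫ x, ‖(∏ i, h (x i)) * S 2 x‖ := norm_integral_le_integral_norm _
    _ ≤ ∫ x, s ^ 2 * (C * (4 : ℝ) ^ a) * D x :=
        integral_mono_of_nonneg (Eventually.of_forall fun x => norm_nonneg _)
          (hDint.const_mul _) hdom
    _ = C * (4 : ℝ) ^ a * (∫ x, D x) * s ^ 2 := by rw [integral_const_mul]; ring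

/-- **Continuity of the limit functional on `𝒮(ℝ³)`.**
[cite: GelfandVilenkinIV1964, Ch. IV §4.2 Thm. 1 (p. 348)] -/
theorem continuous_limitFunctional (hlim : HasPointwiseScalingLimit (criticalCorr 3) ρ S)
    (hnd : IsNondegenerateTwoPoint S) (hsc : IsScaleCovariant Δ S) (hΔ0 : 0 < Δ) (hΔ : Δ < 3 / 2)
    (hν : ∀ A : Finset (Site 3), spinCorr ν A = plusCorr 3 (criticalBeta 3) 0 A)
    (hL : Tendsto (fun δ => δ * L δ) (𝓝[>] 0) atTop) :
    Continuous (fun f : SchwartzMap (EuclideanSpace ℝ (Fin 3)) ℝ =>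
      ∑' n : ℕ, I ^ n * ((∫ x : Fin n → EuclideanSpace ℝ (Fin 3),
        (∏ i, f (x i)) * S n x : ℝ) : ℂ) / n !) := by
  obtain ⟨A, hA, hQ⟩ := exists_limitVariance_le hlim hnd hsc hΔ0 hΔ
  -- the controlling seminorm is continuous
  set sfun : SchwartzMap (EuclideanSpace ℝ (Fin 3)) ℝ → ℝ := fun h =>
    2 ^ 4 * ((Finset.Iic ((4, 0) : ℕ × ℕ)).sup (schwartzSeminormFamily ℝ (EuclideanSpace ℝ (Fin 3)) ℝ)) h with hsfun
  have hscont : Continuous sfun := continuous_const.mul (Seminorm.continuous_finsetSup fun m _ =>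
    (schwartz_withSeminorms ℝ (EuclideanSpace ℝ (Fin 3)) ℝ).continuous_seminorm m)
  refine continuous_iff_continuousAt.2 fun g => ?_
  rw [ContinuousAt, Metric.tendsto_nhds]
  intro ε hε
  -- smallness of the seminorm of `f - g` near `g`
  set θ : ℝ := min 1 (ε ^ 2 / (2 * (A + 1))) with hθ
  have hθpos : 0 < θ := lt_min one_pos (by positivity)
  have hθ1 : θ ≤ 1 := min_le_left _ _
  have hθA : A * θ ≤ ε ^ 2 / 2 := by
    calc A * θ ≤ A * (ε ^ 2 / (2 * (A + 1))) := mul_le_mul_of_nonneg_left (min_le_right _ _) hA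
      _ = (A / (A + 1)) * (ε ^ 2 / 2) := by field_simp
      _ ≤ 1 * (ε ^ 2 / 2) := by
          refine mul_le_mul_of_nonneg_right ((div_le_one (by positivity)).2 (by linarith)) (by positivity)
      _ = ε ^ 2 / 2 := one_mul _
  have hsg : Tendsto (fun f => sfun (f - g)) (𝓝 g) (𝓝 0) := by
    have h := (hscont.comp (continuous_sub_right g)).tendsto g
    simp only [Function.comp_apply, sub_self] at h
    have h0 : sfun 0 = 0 := by simp only [hsfun, map_zero, mul_zero]
    rwa [h0] at h
  filter_upwards [(tendsto_order.1 hsg).2 θ hθpos] with f hf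
  have hsf0 : 0 ≤ sfun (f - g) := by simp only [hsfun]; positivity
  have hQfg : (∫ x : Fin 2 → EuclideanSpace ℝ (Fin 3), (∏ i, (f - g) (x i)) * S 2 x) / (2 * ε) <
      ε / 2 := by
    rw [div_lt_iff₀ (by positivity)]
    have h1 := (le_abs_self _).trans (hQ (f - g))
    have h2 : (sfun (f - g)) ^ 2 ≤ θ := by
      calc (sfun (f - g)) ^ 2 ≤ θ ^ 2 := pow_le_pow_left₀ hsf0 hf.le 2
        _ ≤ θ := by rw [sq]; exact mul_le_of_le_one_left hθpos.le hθ1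
    have h3 : A * (sfun (f - g)) ^ 2 ≤ ε ^ 2 / 2 := (mul_le_mul_of_nonneg_left h2 hA).trans hθA
    change _ ≤ A * (sfun (f - g)) ^ 2 at h1
    nlinarith
  have key := norm_limitFunctional_sub_le hlim hnd hsc hΔ0 hΔ hν hL f g hε
  rw [dist_eq_norm]
  linarith

/-! ### The continuum law -/

/-- **The continuum law exists** (Minlos): there is a probability measure `μ` on the field
configurations over `ℝ³` whose generating functional is the limit functional `C`, and the smeared
critical fields converge to `μ` in law. [cite: Minlos1959] -/
theorem exists_limitLaw (hlim : HasPointwiseScalingLimit (criticalCorr 3) ρ S)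
    (hnd : IsNondegenerateTwoPoint S) (hsc : IsScaleCovariant Δ S) (hΔ0 : 0 < Δ) (hΔ : Δ < 3 / 2)
    (hν : ∀ A : Finset (Site 3), spinCorr ν A = plusCorr 3 (criticalBeta 3) 0 A)
    (hL : Tendsto (fun δ => δ * L δ) (𝓝[>] 0) atTop) :
    ∃ μ : Measure (FieldConfig (EuclideanSpace ℝ (Fin 3))), IsProbabilityMeasure μ ∧
      (∀ f, genFunctional μ f = ∑' n : ℕ, I ^ n * ((∫ x : Fin n → EuclideanSpace ℝ (Fin 3),
        (∏ i, f (x i)) * S n x : ℝ) : ℂ) / n !) ∧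
      TendstoInLaw (fun δ => spinFieldLaw ν (box 3 (L δ)) δ (ρ δ)) (𝓝[>] 0) μ := by
  have hC : IsCharacteristicFunctional (fun f : SchwartzMap (EuclideanSpace ℝ (Fin 3)) ℝ =>
      ∑' n : ℕ, I ^ n * ((∫ x : Fin n → EuclideanSpace ℝ (Fin 3),
        (∏ i, f (x i)) * S n x : ℝ) : ℂ) / n !) :=
    ⟨limitFunctional_zero hlim hnd hsc hΔ0 hΔ hν hL,
      continuous_limitFunctional hlim hnd hsc hΔ0 hΔ hν hL,
      limitFunctional_posDef hlim hnd hsc hΔ0 hΔ hν hL⟩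
  obtain ⟨μ, ⟨hμP, hμC⟩, -⟩ :=
    Literature.Analysis.FunctionSpaces.schwartz_minlos_holds (E := EuclideanSpace ℝ (Fin 3)) _ hC
  refine ⟨μ, hμP, hμC, fun f => ?_⟩
  rw [hμC]
  exact tendsto_genFunctional_spinFieldLaw hlim hnd hsc hΔ0 hΔ hν hL f

end Summit.CriticalPhenomena.Ising3DConformalLimit.MarkovRigidityFieldRealisation

end
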